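import Mathlib.Analysis.Complex.CoveringMap
import Mathlib.Analysis.SpecialFunctions.Complex.LogDeriv
import Mathlib.Analysis.Complex.Convex
import Mathlib.Analysis.Convex.Contractible
import Mathlib.Topology.Homotopy.Lifting
import HarnessLib

/-!
# Sheets of a covering over a punctured disc with trivial winding monodromy

Topic `Literature/Topology/CoveringSpaces` (general topology; companion of `PunctureFill.lean` and
`ExteriorDiscCovering.lean`).  O. Forster, *Lectures on Riemann Surfaces*, GTM 81 (1981), §5,
Thm. 5.10/5.11 and §8, Thm. 8.4: a finite unbranched covering of the punctured disc `D*` is, on each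
connected component, a power map `z ↦ z^k`; it extends to an unbranched covering of the disc iff
every `k = 1`, i.e. iff the winding loop of `D*` lifts to CLOSED loops.  We prove the topological
statement in the form consumed by `PunctureFill.isCoveringMap_proj` (filling the puncture).

**Setting.**  `X` a space, `x₀ : X`, a *pointed chart* `ψ : ℂ → X` — continuous, injective and open on
`Metric.ball 0 r` (`r > 0`), `ψ 0 = x₀`, so that `W := ψ(ball 0 r)` is an open neighbourhood of `x₀`
with `ψ(D*_r) = W ∖ {x₀}` (`image_puncturedDisc_eq`) — and `p : E → X` a covering map ON `W ∖ {x₀}`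
(Mathlib `IsCoveringMapOn`).

**Theorem** (`exists_puncture_sheets`).  If for ONE radius `0 < s < r` and starting angle `θ₀` the
winding loop `t ↦ ψ(s e^{i(θ₀ + 2πt)})` has trivial monodromy — every lift `Γ : [0,1] → E` of it
through `p` satisfies `Γ 1 = Γ 0` — then `p⁻¹(W ∖ {x₀})` is the disjoint union of open SHEETS `U e`,
indexed by the fibre `e ∈ p⁻¹{ψ(s e^{iθ₀})}`, each containing its index and each mapped by `p`
bijectively onto `W ∖ {x₀}`: exactly the hypotheses `hU`, `hdisj`, `himg`, `hinj`, `hexh` of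
`PunctureFill.isCoveringMap_proj` (with `ι` the fibre, finite for a finite covering).  The corollary
`exists_puncture_sheets_of_chart` is the case `ψ w = φ⁻¹(φ x₀ + w)` of a chart
`φ : OpenPartialHomeomorph X ℂ` at `x₀` (e.g. `chartAt ℂ x₀` on a Riemann surface).

**Proof** (Forster's, §5 Thm. 5.10).  `P(ζ) = ψ(e^ζ)` maps the convex (simply connected) half-plane
`H = {Re ζ < log r}` onto `W ∖ {x₀}`, is open (`Complex.isOpenMap_exp`, `ψ` open) and satisfies
`P ζ = P ζ' ↔ ζ' − ζ ∈ 2πiℤ`.  By Mathlib's lifting criterion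
(`IsCoveringMapOn.existsUnique_continuousMap_lifts`) `P` lifts through `p` to `L : H → E` through any
prescribed point; the winding-loop hypothesis applied to `t ↦ L(log s + i(θ₀ + 2πt))` gives
`L(a₀ + 2πi) = L(a₀)` (`a₀ = log s + iθ₀`), hence by uniqueness of lifts every lift is `2πiℤ`-periodic.
The sheets are the ranges `U e = L_e(H)` of the lifts `L_e(a₀) = e`: open (a lift is locally
`(p|_{sheet of p})⁻¹ ∘ P`), `p` injective on them and pairwise disjoint (periodicity + uniqueness),
exhausting `p⁻¹(W ∖ {x₀})` (the lift through any point `y` is the lift through its value at `a₀`).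

THEOREMS ONLY (no definitions): the half-plane, `P`, the lifts and the sheets live inside the proof.
Written for the sub-DAG of [AbsTopIII] Cor. 2.7 (b) (abelian finite étale coverings of a once-punctured
complex torus extend over the puncture; cell abc-iut, row Cor-27.b.r10, piece F2), but free of that
context and of any complex structure on `X`.

## References

* O. Forster, *Lectures on Riemann Surfaces*, GTM 81, Springer (1981), §5 Thm. 5.10, 5.11; §8
  Thm. 8.4. [Forster1981]
* A. Hatcher, *Algebraic Topology*, CUP (2002), §1.3, Prop. 1.30 (path lifting), 1.33 (lifting
  criterion), 1.34 (uniqueness of lifts). [HatcherAT2002]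
-/

noncomputable section

open Complex hiding I
open Set Filter Topology Function unitInterval

namespace Literature.Topology.CoveringSpaces

/-- For `ψ` injective on the disc `ball 0 r` (`r > 0`) with `ψ 0 = x₀`: the image of the punctured
disc is the image of the disc minus the centre, `ψ(D*_r) = ψ(ball 0 r) ∖ {x₀}` — the two shapes of
"the punctured neighbourhood". [cite: Forster1981, §5 Thm. 5.10 (proof)] -/
theorem image_puncturedDisc_eq {X : Type*} {ψ : ℂ → X} {x₀ : X} {r : ℝ} (hr : 0 < r) (hψ₀ : ψ 0 = x₀)
    (hψi : InjOn ψ (Metric.ball 0 r)) :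
    ψ '' {z : ℂ | z ≠ 0 ∧ ‖z‖ < r} = (ψ '' Metric.ball 0 r) \ {x₀} := by
  have key : ∀ {w : ℂ}, w ∈ Metric.ball (0 : ℂ) r → (ψ w = x₀ ↔ w = 0) := fun hw ↦
    ⟨fun h ↦ hψi hw (Metric.mem_ball_self hr) (h.trans hψ₀.symm), by rintro rfl; exact hψ₀⟩
  ext x
  constructor
  · rintro ⟨w, ⟨hw0, hwr⟩, rfl⟩
    have hw : w ∈ Metric.ball (0 : ℂ) r := by simpa using hwr
    exact ⟨⟨w, hw, rfl⟩, fun h ↦ hw0 ((key hw).1 h)⟩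
  · rintro ⟨⟨w, hw, rfl⟩, hx⟩
    exact ⟨w, ⟨fun h0 ↦ hx ((key hw).2 h0), by simpa using hw⟩, rfl⟩

/-- **Sheets of a covering over a punctured disc with trivial winding monodromy.**  Let `ψ : ℂ → X`
be continuous, injective and open on the disc `ball 0 r` (`r > 0`) with `ψ 0 = x₀`, put
`W = ψ(ball 0 r)`, and let `p : E → X` be a covering map on `W ∖ {x₀}`.  If for some radius
`0 < s < r` and angle `θ₀` every lift `Γ` through `p` of the winding loop `t ↦ ψ(s e^{i(θ₀+2πt)})`,
`t ∈ [0, 1]`, is closed (`Γ 1 = Γ 0`), then there are sheets `U e ⊆ E`, indexed by the fibre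
`e ∈ p⁻¹{ψ(s e^{iθ₀})}`, which are open, pairwise disjoint, contain their index, are each mapped by `p`
bijectively onto `W ∖ {x₀}`, and cover `p⁻¹(W ∖ {x₀})` ("a finite unbranched covering of the
punctured disc all of whose local monodromies are trivial extends to an unbranched covering of the
disc", in the form of the sheet decomposition over the punctured disc).
[cite: Forster1981, §8 Thm. 8.4] [cite: Forster1981, §5 Thm. 5.10 (proof)] -/
theorem exists_puncture_sheets {E X : Type*} [TopologicalSpace E] [TopologicalSpace X]
    {p : E → X} {ψ : ℂ → X} {x₀ : X} {r : ℝ} (hr : 0 < r) (hψ₀ : ψ 0 = x₀)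
    (hψc : ContinuousOn ψ (Metric.ball 0 r)) (hψi : InjOn ψ (Metric.ball 0 r))
    (hψo : ∀ O : Set ℂ, IsOpen O → O ⊆ Metric.ball 0 r → IsOpen (ψ '' O))
    (hcov : IsCoveringMapOn p ((ψ '' Metric.ball 0 r) \ {x₀}))
    {s : ℝ} (hs : 0 < s) (hsr : s < r) (θ₀ : ℝ)
    (hloop : ∀ Γ : C(I, E),
      (∀ t : I, p (Γ t) = ψ ((s : ℂ) * exp (((θ₀ + 2 * Real.pi * (t : ℝ) : ℝ) : ℂ) * Complex.I))) →
        Γ 1 = Γ 0) :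
    ∃ U : p ⁻¹' {ψ (↑s * exp (↑θ₀ * Complex.I))} → Set E,
      (∀ e, IsOpen (U e)) ∧ Pairwise (Disjoint on U) ∧
      (∀ e, p '' U e = (ψ '' Metric.ball 0 r) \ {x₀}) ∧ (∀ e, InjOn p (U e)) ∧
      (∀ e, (e : E) ∈ U e) ∧ p ⁻¹' ((ψ '' Metric.ball 0 r) \ {x₀}) ⊆ ⋃ e, U e := by
  classical
  /- ### the half-plane `H = {Re ζ < log r}` and the parametrisation `P = ψ ∘ exp` -/
  set H : Set ℂ := {ζ : ℂ | ζ.re < Real.log r} with hHdef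
  have hHopen : IsOpen H := isOpen_lt Complex.continuous_re continuous_const
  haveI : ContractibleSpace H :=
    (convex_halfSpace_re_lt (Real.log r)).contractibleSpace ⟨((Real.log r - 1 : ℝ) : ℂ), by
      show ((Real.log r - 1 : ℝ) : ℂ).re < Real.log r
      simp⟩
  haveI : LocallyPathConnectedSpace H := hHopen.locallyPathConnectedSpace
  set W' : Set X := (ψ '' Metric.ball 0 r) \ {x₀} with hW'def
  set b : X := ψ ((s : ℂ) * exp (((θ₀ : ℝ) : ℂ) * Complex.I)) with hbdef
  have hψx₀ : ∀ {w : ℂ}, w ∈ Metric.ball (0 : ℂ) r → (ψ w = x₀ ↔ w = 0) := fun hw ↦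
    ⟨fun h ↦ hψi hw (Metric.mem_ball_self hr) (h.trans hψ₀.symm), by rintro rfl; exact hψ₀⟩
  have hexp_ball : ∀ ζ : H, exp (ζ : ℂ) ∈ Metric.ball (0 : ℂ) r := fun ζ ↦ by
    have h : (ζ : ℂ).re < Real.log r := ζ.2
    rw [Metric.mem_ball, dist_zero_right, norm_exp]
    exact (Real.lt_log_iff_exp_lt hr).1 h
  let P : C(H, X) := ⟨fun ζ ↦ ψ (exp (ζ : ℂ)), hψc.comp_continuous (by fun_prop) hexp_ball⟩
  have hP : ∀ ζ : H, P ζ = ψ (exp (ζ : ℂ)) := fun _ ↦ rfl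
  have hPmem : ∀ ζ : H, P ζ ∈ W' := fun ζ ↦
    ⟨⟨exp (ζ : ℂ), hexp_ball ζ, rfl⟩, fun h ↦ exp_ne_zero (ζ : ℂ) ((hψx₀ (hexp_ball ζ)).1 h)⟩
  have hPsurj : ∀ x ∈ W', ∃ ζ : H, P ζ = x := by
    rintro _ ⟨⟨w, hw, rfl⟩, hx⟩
    have hw0 : w ≠ 0 := fun h0 ↦ hx ((hψx₀ hw).2 h0)
    have hwr : ‖w‖ < r := by simpa using hw
    refine ⟨⟨log w, ?_⟩, ?_⟩
    · show (log w).re < Real.log r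
      rw [Complex.log_re]
      exact Real.log_lt_log (norm_pos_iff.2 hw0) hwr
    · rw [hP]
      exact congr_arg ψ (exp_log hw0)
  have hPeq : ∀ {ζ ζ' : H}, P ζ = P ζ' → ∃ n : ℤ, (ζ : ℂ) = ζ' + n * (2 * Real.pi * Complex.I) :=
    fun {ζ ζ'} h ↦ exp_eq_exp_iff_exists_int.1 (hψi (hexp_ball ζ) (hexp_ball ζ') h)
  have hPopen : ∀ O : Set H, IsOpen O → IsOpen (P '' O) := fun O hO ↦ by
    have h1 : IsOpen (((↑) : H → ℂ) '' O) := hHopen.isOpenMap_subtype_val O hO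
    have h2 : IsOpen (exp '' (((↑) : H → ℂ) '' O)) := Complex.isOpenMap_exp _ h1
    have h3 : exp '' (((↑) : H → ℂ) '' O) ⊆ Metric.ball (0 : ℂ) r := by
      rintro _ ⟨_, ⟨ζ, -, rfl⟩, rfl⟩
      exact hexp_ball ζ
    have h4 := hψo _ h2 h3
    rwa [image_image, image_image] at h4
  /- ### the deck translations `ζ ↦ ζ + 2πi n` of `exp` -/
  have hsh_mem : ∀ (n : ℤ) (ζ : H), (ζ : ℂ) + n * (2 * Real.pi * Complex.I) ∈ H := fun n ζ ↦ by
    have h : (ζ : ℂ).re < Real.log r := ζ.2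
    show ((ζ : ℂ) + n * (2 * Real.pi * Complex.I)).re < Real.log r
    simpa using h
  let sh : ℤ → C(H, H) := fun n ↦
    ⟨fun ζ ↦ ⟨(ζ : ℂ) + n * (2 * Real.pi * Complex.I), hsh_mem n ζ⟩, by fun_prop⟩
  have hsh : ∀ (n : ℤ) (ζ : H), ((sh n ζ : H) : ℂ) = (ζ : ℂ) + n * (2 * Real.pi * Complex.I) :=
    fun _ _ ↦ rfl
  have hsh_add : ∀ (m n : ℤ) (ζ : H), sh (m + n) ζ = sh m (sh n ζ) := fun m n ζ ↦ by
    apply Subtype.ext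
    simp only [hsh, Int.cast_add]
    ring
  have hsh_zero : ∀ ζ : H, sh 0 ζ = ζ := fun ζ ↦ Subtype.ext (by simp [hsh])
  have hPsh : ∀ (n : ℤ) (ζ : H), P (sh n ζ) = P ζ := fun n ζ ↦ by
    rw [hP, hP, hsh, exp_add, exp_int_mul_two_pi_mul_I, mul_one]
  /- ### lifts of `P` through `p`: existence and uniqueness (lifting criterion on `H`) -/
  have hex : ∀ (a : H) (e : E), p e = P a → ∃ L : C(H, E), L a = e ∧ p ∘ L = ⇑P :=
    fun a e he ↦ (hcov.existsUnique_continuousMap_lifts P he hPmem).exists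
  have huniq : ∀ (L L' : C(H, E)), p ∘ L = ⇑P → p ∘ L' = ⇑P → ∀ a, L a = L' a → L = L' :=
    fun L L' hL hL' a ha ↦
      (hcov.existsUnique_continuousMap_lifts P (e₀ := L a) (by rw [← hL]; rfl) hPmem).unique
        ⟨rfl, hL⟩ ⟨ha.symm, hL'⟩
  /- ### the base parameter `a₀ = log s + iθ₀` and the segment lifting the winding loop -/
  have hlogs : Real.log s < Real.log r := Real.log_lt_log hs hsr
  let a₀ : H := ⟨(Real.log s : ℂ) + ((θ₀ : ℝ) : ℂ) * Complex.I, by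
    show ((Real.log s : ℂ) + ((θ₀ : ℝ) : ℂ) * Complex.I).re < Real.log r
    simpa using hlogs⟩
  have hexp_logs : exp ((Real.log s : ℝ) : ℂ) = (s : ℂ) := by
    rw [← ofReal_exp, Real.exp_log hs]
  have hPa₀ : P a₀ = b := by
    rw [hP, hbdef]
    change ψ (exp ((Real.log s : ℂ) + ((θ₀ : ℝ) : ℂ) * Complex.I)) = _
    rw [exp_add, hexp_logs]
  let seg : C(I, H) := ⟨fun t ↦ ⟨(Real.log s : ℂ) + (((θ₀ + 2 * Real.pi * (t : ℝ) : ℝ) : ℂ) * Complex.I), by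
      show ((Real.log s : ℂ) + (((θ₀ + 2 * Real.pi * (t : ℝ) : ℝ) : ℂ) * Complex.I)).re < Real.log r
      simpa using hlogs⟩, by fun_prop⟩
  have hseg : ∀ t : I, ((seg t : H) : ℂ) =
      (Real.log s : ℂ) + (((θ₀ + 2 * Real.pi * (t : ℝ) : ℝ) : ℂ) * Complex.I) := fun _ ↦ rfl
  have hseg0 : seg 0 = a₀ := Subtype.ext (by rw [hseg]; simp; rfl)
  have hseg1 : seg 1 = sh 1 a₀ := Subtype.ext (by
    rw [hseg, hsh]
    simp only [Set.Icc.coe_one, mul_one, Int.cast_one, one_mul]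
    push_cast
    ring)
  have hPseg : ∀ t : I,
      P (seg t) = ψ ((s : ℂ) * exp (((θ₀ + 2 * Real.pi * (t : ℝ) : ℝ) : ℂ) * Complex.I)) := fun t ↦ by
    rw [hP, hseg, exp_add, hexp_logs]
  /- ### trivial winding monodromy ⇒ every lift of `P` is `2πiℤ`-periodic -/
  have hper1 : ∀ L : C(H, E), p ∘ L = ⇑P → ∀ ζ, L (sh 1 ζ) = L ζ := by
    intro L hL
    have hpL : ∀ ζ, p (L ζ) = P ζ := fun ζ ↦ congr_fun hL ζ
    -- the lift `t ↦ L(log s + i(θ₀ + 2πt))` of the winding loop is closed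
    have hclosed : L (sh 1 a₀) = L a₀ := by
      have h := hloop (L.comp seg) fun t ↦ by
        change p (L (seg t)) = _
        rw [hpL, hPseg]
      change L (seg 1) = L (seg 0) at h
      rwa [hseg1, hseg0] at h
    -- `L ∘ sh 1` is a lift of `P` agreeing with `L` at `a₀`
    have key : L.comp (sh 1) = L :=
      huniq (L.comp (sh 1)) L (funext fun ζ ↦ by
        change p (L (sh 1 ζ)) = P ζ
        rw [hpL, hPsh]) hL a₀ hclosed
    intro ζ
    exact congr_fun (congr_arg DFunLike.coe key) ζ
  have hper : ∀ L : C(H, E), p ∘ L = ⇑P → ∀ (n : ℤ) (ζ : H), L (sh n ζ) = L ζ := by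
    intro L hL n
    refine Int.induction_on n (fun ζ ↦ by rw [hsh_zero]) (fun i ih ζ ↦ ?_) (fun i ih ζ ↦ ?_)
    · rw [hsh_add, ih, hper1 L hL]
    · have hneg1 : ∀ ζ, L (sh (-1) ζ) = L ζ := fun ζ ↦ by
        have h := hper1 L hL (sh (-1) ζ)
        rw [← hsh_add, add_neg_cancel, hsh_zero] at h
        exact h.symm
      rw [sub_eq_add_neg, hsh_add, ih, hneg1]
  have hperP : ∀ L : C(H, E), p ∘ L = ⇑P → ∀ {ζ ζ' : H}, P ζ = P ζ' → L ζ = L ζ' := by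
    intro L hL ζ ζ' h
    obtain ⟨n, hn⟩ := hPeq h
    have hζ : ζ = sh n ζ' := Subtype.ext (by rw [hsh, hn])
    rw [hζ, hper L hL]
  /- ### the lifts through the fibre over `b = ψ(s e^{iθ₀})` and their ranges, the sheets -/
  have hb : ∀ e : p ⁻¹' {b}, p e = P a₀ := fun e ↦ by rw [hPa₀]; exact e.2
  choose L hLa hLp using fun e : p ⁻¹' {b} ↦ hex a₀ e (hb e)
  have hpL : ∀ (e : p ⁻¹' {b}) (ζ : H), p (L e ζ) = P ζ := fun e ζ ↦ congr_fun (hLp e) ζ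
  refine ⟨fun e ↦ range (L e), fun e ↦ ?_, fun e e' hne ↦ ?_, fun e ↦ ?_, fun e ↦ ?_,
    fun e ↦ ⟨a₀, hLa e⟩, fun y hy ↦ ?_⟩
  · /- the sheet is open: near `ζ₁`, `L e = φ⁻¹ ∘ P` for the local homeomorphism `φ` of `p` -/
    refine isOpen_iff_forall_mem_open.2 ?_
    rintro _ ⟨ζ₁, rfl⟩
    obtain ⟨φ, hkφ, hφ⟩ := hcov.isLocalHomeomorphOn (L e ζ₁) (by
      show p (L e ζ₁) ∈ W'
      rw [hpL]
      exact hPmem ζ₁)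
    have hB : IsOpen (L e ⁻¹' φ.source) := φ.open_source.preimage (L e).continuous
    refine ⟨L e '' (L e ⁻¹' φ.source), image_subset_range _ _, ?_, ⟨ζ₁, hkφ, rfl⟩⟩
    have h1 : ∀ ζ, φ (L e ζ) = P ζ := fun ζ ↦ by rw [← hφ]; exact hpL e ζ
    have heq : L e '' (L e ⁻¹' φ.source) = φ.symm '' (P '' (L e ⁻¹' φ.source)) := by
      rw [image_image]
      refine image_congr fun ζ hζ ↦ ?_
      rw [← h1, φ.left_inv hζ]
    rw [heq]
    refine φ.symm.isOpen_image_of_subset_source (hPopen _ hB) ?_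
    rintro _ ⟨ζ, hζ, rfl⟩
    rw [φ.symm_source, ← h1]
    exact φ.map_source hζ
  · /- distinct sheets are disjoint: a common point makes the lifts agree everywhere -/
    show Disjoint (range (L e)) (range (L e'))
    rw [disjoint_iff_forall_ne]
    rintro y ⟨ζ, rfl⟩ _ ⟨ζ', rfl⟩ h
    apply hne
    have hPζ : P ζ = P ζ' := by rw [← hpL e ζ, h, hpL]
    have h' : L e ζ = L e' ζ := by rw [h]; exact (hperP (L e') (hLp e') hPζ).symm
    have key : L e = L e' := huniq (L e) (L e') (hLp e) (hLp e') ζ h'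
    apply Subtype.ext
    rw [← hLa e, ← hLa e', key]
  · /- the sheet projects onto the punctured neighbourhood -/
    refine Subset.antisymm ?_ fun x hx ↦ ?_
    · rintro _ ⟨_, ⟨ζ, rfl⟩, rfl⟩
      rw [hpL]
      exact hPmem ζ
    · obtain ⟨ζ, hζ⟩ := hPsurj x hx
      exact ⟨L e ζ, ⟨ζ, rfl⟩, by rw [hpL, hζ]⟩
  · /- `p` is injective on the sheet -/
    rintro _ ⟨ζ, rfl⟩ _ ⟨ζ', rfl⟩ h
    rw [hpL, hpL] at h
    exact hperP (L e) (hLp e) h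
  · /- the sheets exhaust `p⁻¹(W ∖ {x₀})`: the lift through `y` is the lift through its value at `a₀` -/
    obtain ⟨ζ₀, hζ₀⟩ := hPsurj (p y) hy
    obtain ⟨F, hF₀, hFp⟩ := hex ζ₀ y hζ₀.symm
    let e : p ⁻¹' {b} := ⟨F a₀, by
      show p (F a₀) ∈ ({b} : Set X)
      rw [mem_singleton_iff, ← hPa₀]
      exact congr_fun hFp a₀⟩
    have key : L e = F := huniq (L e) F (hLp e) hFp a₀ (hLa e)
    exact mem_iUnion.2 ⟨e, ζ₀, by rw [key, hF₀]⟩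


/-- **Sheets over a punctured chart disc** (corollary for manifold charts): the same statement for the
pointed chart `w ↦ φ⁻¹(φ x₀ + w)` of a partial homeomorphism `φ : X → ℂ` defined at `x₀` whose target
contains the disc `ball (φ x₀) r` — e.g. `φ = chartAt ℂ x₀` on a Riemann surface; the punctured
neighbourhood is `φ⁻¹(ball (φ x₀) r) ∖ {x₀}` and the winding loop is `t ↦ φ⁻¹(φ x₀ + s e^{i(θ₀+2πt)})`.
[cite: Forster1981, §8 Thm. 8.4] -/
theorem exists_puncture_sheets_of_chart {E X : Type*} [TopologicalSpace E] [TopologicalSpace X]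
    {p : E → X} (φ : OpenPartialHomeomorph X ℂ) {x₀ : X} (hx₀ : x₀ ∈ φ.source) {r : ℝ} (hr : 0 < r)
    (hball : Metric.ball (φ x₀) r ⊆ φ.target)
    (hcov : IsCoveringMapOn p ((φ.symm '' Metric.ball (φ x₀) r) \ {x₀})) {s : ℝ} (hs : 0 < s)
    (hsr : s < r) (θ₀ : ℝ)
    (hloop : ∀ Γ : C(I, E),
      (∀ t : I, p (Γ t) =
          φ.symm (φ x₀ + (s : ℂ) * exp (((θ₀ + 2 * Real.pi * (t : ℝ) : ℝ) : ℂ) * Complex.I))) →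
        Γ 1 = Γ 0) :
    ∃ U : p ⁻¹' {φ.symm (φ x₀ + ↑s * exp (↑θ₀ * Complex.I))} → Set E,
      (∀ e, IsOpen (U e)) ∧ Pairwise (Disjoint on U) ∧
      (∀ e, p '' U e = (φ.symm '' Metric.ball (φ x₀) r) \ {x₀}) ∧ (∀ e, InjOn p (U e)) ∧
      (∀ e, (e : E) ∈ U e) ∧ p ⁻¹' ((φ.symm '' Metric.ball (φ x₀) r) \ {x₀}) ⊆ ⋃ e, U e := by
  -- the pointed chart `ψ w = φ⁻¹(φ x₀ + w)`
  set ψ : ℂ → X := fun w ↦ φ.symm (φ x₀ + w) with hψ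
  have hadd_mem : ∀ {w : ℂ}, w ∈ Metric.ball (0 : ℂ) r → φ x₀ + w ∈ Metric.ball (φ x₀) r := fun hw ↦ by
    rw [Metric.mem_ball, dist_eq_norm] at hw ⊢
    simpa using hw
  have hadd : (fun w : ℂ ↦ φ x₀ + w) '' Metric.ball 0 r = Metric.ball (φ x₀) r := by
    ext z
    constructor
    · rintro ⟨w, hw, rfl⟩
      exact hadd_mem hw
    · intro hz
      refine ⟨z - φ x₀, ?_, by abel⟩
      rw [Metric.mem_ball, dist_eq_norm] at hz
      simpa [Metric.mem_ball, dist_eq_norm] using hz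
  have hψ₀ : ψ 0 = x₀ := by simp [hψ, φ.left_inv hx₀]
  have hψc : ContinuousOn ψ (Metric.ball 0 r) :=
    φ.continuousOn_symm.comp (by fun_prop) fun w hw ↦ hball (hadd_mem hw)
  have hψi : InjOn ψ (Metric.ball 0 r) := fun w hw w' hw' h ↦ by
    have h' : φ x₀ + w = φ x₀ + w' :=
      φ.symm.injOn (by rw [φ.symm_source]; exact hball (hadd_mem hw))
        (by rw [φ.symm_source]; exact hball (hadd_mem hw')) h
    exact add_left_cancel h'
  have hψo : ∀ O : Set ℂ, IsOpen O → O ⊆ Metric.ball 0 r → IsOpen (ψ '' O) := fun O hO hOr ↦ by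
    have h1 : IsOpen ((fun w : ℂ ↦ φ x₀ + w) '' O) := isOpenMap_add_left (φ x₀) O hO
    have h2 : (fun w : ℂ ↦ φ x₀ + w) '' O ⊆ φ.symm.source := by
      rintro _ ⟨w, hw, rfl⟩
      rw [φ.symm_source]
      exact hball (hadd_mem (hOr hw))
    have h3 := φ.symm.isOpen_image_of_subset_source h1 h2
    rwa [image_image] at h3
  have himg : ψ '' Metric.ball 0 r = φ.symm '' Metric.ball (φ x₀) r := by
    rw [← hadd, image_image]
  have hcov' : IsCoveringMapOn p ((ψ '' Metric.ball 0 r) \ {x₀}) := by rwa [himg]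
  have key := exists_puncture_sheets hr hψ₀ hψc hψi hψo hcov' hs hsr θ₀ hloop
  rw [himg] at key
  exact key


/-- **Sheets from closed `liftPath`s** (the same statement in Mathlib's path-lifting vocabulary, for a
covering `q : E → S` of an OPEN subspace `S ⊆ X` containing the punctured chart neighbourhood — e.g.
`S = X ∖ {x₀}`): if the winding loop, read as a path `γ` in `S`, lifts through `q` to CLOSED paths
from every point of its fibre (`q.liftPath γ e _ 1 = e`, the output of trivial monodromy, cf.
`IsCoveringMap.monodromy`), then `p = Subtype.val ∘ q` admits the sheet decomposition of
`exists_puncture_sheets` over `ψ(ball 0 r) ∖ {x₀}`. [cite: Forster1981, §8 Thm. 8.4] -/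
theorem exists_puncture_sheets_of_liftPath {E X : Type*} [TopologicalSpace E] [TopologicalSpace X]
    {S : Set X} (hS : IsOpen S) {q : E → S} (hq : IsCoveringMap q) {ψ : ℂ → X} {x₀ : X} {r : ℝ}
    (hr : 0 < r) (hψ₀ : ψ 0 = x₀) (hψc : ContinuousOn ψ (Metric.ball 0 r))
    (hψi : InjOn ψ (Metric.ball 0 r))
    (hψo : ∀ O : Set ℂ, IsOpen O → O ⊆ Metric.ball 0 r → IsOpen (ψ '' O))
    (hWS : (ψ '' Metric.ball 0 r) \ {x₀} ⊆ S) {s : ℝ} (hs : 0 < s) (hsr : s < r) (θ₀ : ℝ)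
    {b : S} (γ : Path b b)
    (hγ : ∀ t : I, (γ t : X) = ψ ((s : ℂ) * exp (((θ₀ + 2 * Real.pi * (t : ℝ) : ℝ) : ℂ) * Complex.I)))
    (hlift : ∀ (e : E) (he : γ 0 = q e), hq.liftPath γ e he 1 = e) :
    ∃ U : (Subtype.val ∘ q) ⁻¹' {ψ (↑s * exp (↑θ₀ * Complex.I))} → Set E,
      (∀ e, IsOpen (U e)) ∧ Pairwise (Disjoint on U) ∧
      (∀ e, (Subtype.val ∘ q) '' U e = (ψ '' Metric.ball 0 r) \ {x₀}) ∧
      (∀ e, InjOn (Subtype.val ∘ q) (U e)) ∧ (∀ e, (e : E) ∈ U e) ∧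
      (Subtype.val ∘ q) ⁻¹' ((ψ '' Metric.ball 0 r) \ {x₀}) ⊆ ⋃ e, U e := by
  -- `val ∘ q` is a covering map on the punctured neighbourhood (`S` is open)
  have hcov : IsCoveringMapOn (Subtype.val ∘ q) ((ψ '' Metric.ball 0 r) \ {x₀}) := fun x hx ↦
    ((hq ⟨x, hWS hx⟩).subtypeVal_comp _ hS).to_isEvenlyCovered_preimage
  refine exists_puncture_sheets hr hψ₀ hψc hψi hψo hcov hs hsr θ₀ fun Γ hΓ ↦ ?_
  -- a lift of the winding loop through `val ∘ q` is a lift of `γ` through `q`, hence `liftPath γ (Γ 0)`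
  have hqΓ : q ∘ Γ = ⇑γ := funext fun t ↦ Subtype.ext ((hΓ t).trans (hγ t).symm)
  have h0 : γ 0 = q (Γ 0) := by rw [← Function.comp_apply (f := q) (g := Γ), hqΓ]
  have hΓeq : Γ = hq.liftPath γ (Γ 0) h0 := (hq.eq_liftPath_iff' h0).2 ⟨hqΓ, rfl⟩
  have h1 : Γ 1 = hq.liftPath γ (Γ 0) h0 1 := by rw [← hΓeq]
  rw [h1, hlift (Γ 0) h0]

end Literature.Topology.CoveringSpaces
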